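import Summits.CriticalPhenomena.PercolationContinuityZ3.Theorems.Transplant.FKConnectivityAllQWheelRayleigh
import Summits.CriticalPhenomena.PercolationContinuityZ3.Theorems.Transplant.FKConnectivityAllQEmbedding
import HarnessLib

/-!
# Connectivity correlation inequalities for `φ_{w,q}`, every `q > 0` — WHEELS INSIDE AN ARBITRARY FINITE VERTEX TYPE are Potts–Rayleigh, `0 < q ≤ 1`

Support file (`--supports stmt-CriticalPhenomena-4575`), FK sub-lane `prim-bschramm-fk-3` (gen 8) of the post-continuity programme; builds on
p205010 (kernel theorem, internal audit signed; external expert review pending).  No definitions, no named facts, no sorries; standard axioms.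

`edgeNegCorrSupp_wheel` (`…AllQWheelRayleigh.lean`) is stated for a vertex type of cardinality exactly `n + 1`.  Here the cardinality hypothesis is
removed by transport along the inclusion of the wheel's vertex set (`EdgeNegCorrSupp.image`, `…AllQEmbedding.lean`):
**`FK.Wheel.edgeNegCorrSupp_wheelPairs`** — for EVERY finite `U`, every hub `h : U`, every `n ≥ 3` and rim vertices `u 0, …, u (n−1)` pairwise distinct
and `≠ h`, and every `0 < q ≤ 1`: `EdgeNegCorrSupp ↑(wheelPairs h u n) q`.  This is the block form in which wheels can join the two-sum calculus of
`…AllQTwoSumClass.lean` (2-trees, `K₄`'s, parallel connections). (transcription of bschramm/prim-bschramm-fk-3/WHEELS-HUB-NC.md §10)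
[cite: Grimmett2006, §3.9 eq. (3.94), Conj. (3.96) (pp. 63–66)] [cite: Wagner2006, Conj. 5.3, §5.3 (pp. 13–15)]
-/

noncomputable section

namespace Summit.CriticalPhenomena.PercolationContinuityZ3.Theorems

namespace FK

namespace Wheel

open MeasureTheory Set Literature.Probability.LatticeModels Literature.Probability.Percolation
open scoped Classical

variable {U : Type*} [Fintype U]

omit [Fintype U] in
/-- Spokes are transported by maps: `Sym2.map f (spokePair x v n i) = spokePair (f x) (f ∘ v) n i`. [folklore] -/
theorem map_spokePair {W : Type*} (f : W → U) (x : W) (v : ℕ → W) (n i : ℕ) :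
    Sym2.map f (spokePair x v n i) = spokePair (f x) (f ∘ v) n i := by
  unfold spokePair; simp

omit [Fintype U] in
/-- Rim pairs are transported by maps: `Sym2.map f (rimPair v n i) = rimPair (f ∘ v) n i`. [folklore] -/
theorem map_rimPair {W : Type*} (f : W → U) (v : ℕ → W) (n i : ℕ) :
    Sym2.map f (rimPair v n i) = rimPair (f ∘ v) n i := by
  unfold rimPair; simp

omit [Fintype U] in
/-- The wheel pairs are transported by maps. [folklore] -/
theorem image_wheelPairs {W : Type*} (f : W → U) (x : W) (v : ℕ → W) (n : ℕ) :
    Sym2.map f '' (↑(wheelPairs x v n) : Set (Sym2 W)) = ↑(wheelPairs (f x) (f ∘ v) n) := by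
  ext e
  simp only [Set.mem_image, Finset.mem_coe, mem_wheelPairs_iff]
  constructor
  · rintro ⟨g, hg, rfl⟩
    rcases hg with ⟨j, hj, rfl⟩ | ⟨j, hj, rfl⟩
    · exact Or.inl ⟨j, hj, map_spokePair f x v n j⟩
    · exact Or.inr ⟨j, hj, map_rimPair f v n j⟩
  · rintro (⟨j, hj, rfl⟩ | ⟨j, hj, rfl⟩)
    · exact ⟨spokePair x v n j, Or.inl ⟨j, hj, rfl⟩, map_spokePair f x v n j⟩
    · exact ⟨rimPair v n j, Or.inr ⟨j, hj, rfl⟩, map_rimPair f v n j⟩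

omit [Fintype U] in
/-- Rim pairs only see the rim map modulo `n`. [folklore] -/
theorem wheelPairs_congr (x : U) {v v' : ℕ → U} (n : ℕ) (h : ∀ j, j < n → v j = v' j) : wheelPairs x v n = wheelPairs x v' n := by
  rcases Nat.eq_zero_or_pos n with rfl | hn
  · simp [wheelPairs]
  ext e
  simp only [mem_wheelPairs_iff, spokePair, rimPair, h _ (Nat.mod_lt _ hn)]

/-- **WHEELS IN ANY FINITE VERTEX TYPE ARE POTTS–RAYLEIGH, `0 < q ≤ 1`**: for a hub `h`, `n ≥ 3` rim vertices `u 0, …, u (n−1)` pairwise distinct and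
different from `h`, every weight vector supported on the wheel pairs `s(h, u j)`, `s(u j, u (j+1 mod n))` and every two distinct pairs `e ≠ f`:
`φ_{w,q}(J_e ∩ J_f) ≤ φ_{w,q}(J_e)·φ_{w,q}(J_f)`. (transcription of bschramm/prim-bschramm-fk-3/WHEELS-HUB-NC.md §10)
[cite: Grimmett2006, §3.9 eq. (3.94), Conj. (3.96) (pp. 63–66)] [cite: Wagner2006, Conj. 5.3, §5.3 (pp. 13–15)] -/
theorem edgeNegCorrSupp_wheelPairs {q : ℝ} (hq0 : 0 < q) (hq1 : q ≤ 1) (h : U) (u : ℕ → U) {n : ℕ} (hn : 3 ≤ n)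
    (hinj : ∀ j k, j < n → k < n → u j = u k → j = k) (hux : ∀ j, j < n → u j ≠ h) :
    EdgeNegCorrSupp (↑(wheelPairs h u n) : Set (Sym2 U)) q := by
  -- the vertex set of the wheel as a type of cardinality `n + 1`
  set T : Finset U := insert h ((Finset.range n).image u) with hT
  have hn0 : 0 < n := by omega
  have hmemu : ∀ i, u (i % n) ∈ T := fun i =>
    Finset.mem_insert_of_mem (Finset.mem_image_of_mem u (Finset.mem_range.2 (Nat.mod_lt i hn0)))
  have hcardT : T.card = n + 1 := by
    have hnot : h ∉ (Finset.range n).image u := by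
      intro hm
      obtain ⟨j, hj, hju⟩ := Finset.mem_image.1 hm
      exact hux j (Finset.mem_range.1 hj) hju
    rw [hT, Finset.card_insert_of_notMem hnot, Finset.card_image_of_injOn, Finset.card_range]
    intro j hj k hk hjk
    exact hinj j k (Finset.mem_range.1 (Finset.mem_coe.1 hj)) (Finset.mem_range.1 (Finset.mem_coe.1 hk)) hjk
  let x : ↥T := ⟨h, Finset.mem_insert_self h _⟩
  let v : ℕ → ↥T := fun i => ⟨u (i % n), hmemu i⟩
  have hcard : Fintype.card ↥T = n + 1 := by rw [Fintype.card_coe, hcardT]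
  have hinj' : ∀ j k, j < n → k < n → v j = v k → j = k := by
    intro j k hj hk hjk
    have := congrArg Subtype.val hjk
    simp only [v, Nat.mod_eq_of_lt hj, Nat.mod_eq_of_lt hk] at this
    exact hinj j k hj hk this
  have hx' : ∀ j, j < n → v j ≠ x := by
    intro j hj hjx
    have := congrArg Subtype.val hjx
    simp only [v, x, Nat.mod_eq_of_lt hj] at this
    exact hux j hj this
  have key := edgeNegCorrSupp_wheel (V := ↥T) (x := x) (v := v) hn hinj' hx' hcard hq0 hq1
  have img := EdgeNegCorrSupp.image (Function.Embedding.subtype (· ∈ T)) hq0 key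
  rw [image_wheelPairs] at img
  -- identify the transported wheel with the given one
  have hxval : (Function.Embedding.subtype (· ∈ T)) x = h := rfl
  have hv : ∀ j, j < n → ((Function.Embedding.subtype (· ∈ T)) ∘ v) j = u j := by
    intro j hj
    simp [v, Nat.mod_eq_of_lt hj]
  rwa [hxval, wheelPairs_congr h n hv] at img

end Wheel

end FK

end Summit.CriticalPhenomena.PercolationContinuityZ3.Theorems
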